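import Summits.HodgeConjecture.HodgeConjecture.Theorems.Ring2WeilCoverageCMFieldNormResidueSymbols
import HarnessLib

/-!
# Ring 2 — Weil-family coverage, CM-field rows: the `T`-sets at the infinite places, their PARITY (Hilbert
  reciprocity) and their REALISATION (O'Meara 71:19) — the polarized components `W_{2k}.E.δ` ↔ the finite even
  subsets of the non-split finite places of `F` (WEIL-FAMILY-COVERAGE «## b03», open cell (ix′), part 2)

research route conditional on HC_CM; not a corollary; Q11.4-sentence-2 already refuted in dim ≥ 3.

Sequel of `Ring2WeilCoverageCMFieldNormResidueSymbols` (`[q] = [q'] ⟺ T(q) = T(q')`, `T(q) = badPlaces q θ`, on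
Deligne's carriers `F = ℚ[S]/(R) ⊂ E = ℚ[T]/(R(T²)) = F(√θ)`) [cite: Deligne1982HodgeCycles, §4: display (1),
Prop. 4.1 and Cor. 4.2 — p. 28 of the re-edition of LNM 900]:

* §4 the infinite places (roots of `R` real negative, the standing `hroots`): `θ` is totally negative, so
  `(q, θ)_w = 1 ⟺ q >_w 0` and `T(q)` has no infinite place iff `q` is TOTALLY POSITIVE; total positivity on `F`
  is the `Re τ(ι q) > 0 ∀τ` of `Ring2WeilCoverageCMFieldCellsSign` / `…KaehlerIffAnyCM` (polarized rows); for
  `q, q' ≫ 0`: `[q] = [q']` iff their FINITE bad places agree (`mk_eq_mk_iff_finite_badPlaces_eq`).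
* §5 `even_ncard_badPlaces` (Hilbert reciprocity 71:18, `hilbertReciprocity_holds`): `|T(q)|` is EVEN;
  `not_isSquare_of_hilbertSymbol_eq_neg_one`: `T(q)` consists of NON-SPLIT places (`θ ∉ F_v²`);
  `exists_totallyPositive_badPlaces_eq` (O'Meara 71:19, `exists_hilbertSymbol_eq_neg_one_iff_of_hilbertReciprocity`):
  EVERY finite even set of finite places of `F` at which `θ` is a local non-square is `T(q)` for some `q ≫ 0`.
So the totally positive classes of `F^×/Nm_{E/F}(E^×)` — the polarized rows `W_{2k}.E.δ`, `k` even — are in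
canonical bijection with the finite even subsets of the non-split finite places of `F`: the indexing axiom of
§b03.2/§b03.5 («δ ↔ the finite EVEN sets T of places of F non-split in E», tier S) is a kernel theorem for every
carrier.  No new definition, no named fact, no sorry.
-/

noncomputable section

set_option linter.dupNamespace false

open Polynomial NumberField IsDedekindDomain

namespace Summit.HodgeConjecture.HodgeConjecture.Ring2.WeilCoverageCM

open Literature.AlgebraicGeometry.Deligne1982
open Literature.AlgebraicGeometry.HodgeTheory (splitDiscriminantClassCM)
open Literature.NumberTheory.QuadraticForms

variable {R : Polynomial ℤ} [Fact (Irreducible (cmPolyQ R))] [Fact (Irreducible (realPolyQ R))]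

/-! ### §4 The infinite places: `θ` is totally negative, so `(q, θ)_w = 1 ⟺ q >_w 0` -/

omit [Fact (Irreducible (cmPolyQ R))] in
/-- Every real embedding sends `θ` (a root of `R`) to a NEGATIVE real number, the roots of `R` being real and
negative (the standing `hroots`). [cite: Deligne1982HodgeCycles, §4 p. 30] -/
theorem embedding_root_realPolyQ_neg
    (hR : ∀ s : ℂ, Polynomial.eval₂ (Int.castRingHom ℂ) s R = 0 → s.im = 0 ∧ s.re < 0)
    (φ : realField R →+* ℝ) : φ (AdjoinRoot.root (realPolyQ R)) < 0 := by
  have h := (hR _ (eval₂_ringHom_realRoot ((algebraMap ℝ ℂ).comp φ))).2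
  simpa using h

omit [Fact (Irreducible (cmPolyQ R))] in
/-- **At an infinite place `w` of `F`: `(t, θ)_w = 1 ⟺ σ_w(t) > 0`** (`F` is totally real and `σ_w(θ) < 0`; the
real symbol is `-1` iff both entries are `≤ 0`). [cite: Omeara1963, §63B (the symbol over `ℝ`)] -/
theorem hilbertSymbol_completion_root_eq_one_iff
    (hR : ∀ s : ℂ, Polynomial.eval₂ (Int.castRingHom ℂ) s R = 0 → s.im = 0 ∧ s.re < 0)
    (w : InfinitePlace (realField R)) (t : realField R) :
    hilbertSymbol w.Completion (algebraMap (realField R) _ t)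
        (algebraMap (realField R) _ (AdjoinRoot.root (realPolyQ R))) = 1 ↔
      0 < InfinitePlace.embedding_of_isReal ((isTotallyReal_realField (R := R) hR).isReal w) t := by
  rw [hilbertSymbol_completion_eq_one_iff_of_isReal ((isTotallyReal_realField (R := R) hR).isReal w)]
  have hθ := embedding_root_realPolyQ_neg hR
    (InfinitePlace.embedding_of_isReal ((isTotallyReal_realField (R := R) hR).isReal w))
  constructor
  · rintro (h | h)
    · exact h
    · exact absurd h (not_lt.2 hθ.le)
  · exact fun h ↦ Or.inl h

omit [Fact (Irreducible (cmPolyQ R))] in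
/-- **No infinite place lies in `T(t)` iff `t` is TOTALLY POSITIVE** (`φ t > 0` for every real embedding
`φ : F → ℝ`). [cite: Omeara1963, §63B (the symbol over `ℝ`)] [cite: Deligne1982HodgeCycles, §4 (1)] -/
theorem forall_hilbertSymbol_completion_root_eq_one_iff_totallyPositive
    (hR : ∀ s : ℂ, Polynomial.eval₂ (Int.castRingHom ℂ) s R = 0 → s.im = 0 ∧ s.re < 0) (t : realField R) :
    (∀ w : InfinitePlace (realField R), hilbertSymbol w.Completion (algebraMap (realField R) _ t)
        (algebraMap (realField R) _ (AdjoinRoot.root (realPolyQ R))) = 1) ↔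
      ∀ φ : realField R →+* ℝ, 0 < φ t := by
  simp only [hilbertSymbol_completion_root_eq_one_iff hR]
  constructor
  · intro h φ
    let ψ : realField R →+* ℂ := (algebraMap ℝ ℂ).comp φ
    have hψ : ComplexEmbedding.IsReal ψ := by
      rw [ComplexEmbedding.isReal_iff]
      exact RingHom.ext fun x ↦ by
        simp [ψ, ComplexEmbedding.conjugate_coe_eq, Complex.conj_ofReal]
    have h1 := h (InfinitePlace.mk ψ)
    have h2 : ((InfinitePlace.embedding_of_isReal ((isTotallyReal_realField (R := R) hR).isReal
        (InfinitePlace.mk ψ)) t : ℝ) : ℂ) = (φ t : ℂ) := by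
      rw [InfinitePlace.embedding_of_isReal_apply, InfinitePlace.embedding_mk_eq_of_isReal hψ]; rfl
    rwa [Complex.ofReal_inj.1 h2] at h1
  · intro h w
    exact h _

omit [Fact (Irreducible (cmPolyQ R))] in
/-- **`T(q) ⊆ {finite places}` iff `q` is totally positive**: the polarized rows (`δ ≫ 0`, files
`Ring2WeilCoverageCMFieldCellsSign` / `…KaehlerIffAnyCM`) are labelled by finite sets of FINITE places.
[cite: Deligne1982HodgeCycles, §4 (1)] [cite: Omeara1963, §63B] -/
theorem badPlaces_subset_range_inl_iff_totallyPositive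
    (hR : ∀ s : ℂ, Polynomial.eval₂ (Int.castRingHom ℂ) s R = 0 → s.im = 0 ∧ s.re < 0) (t : realField R) :
    badPlaces t (AdjoinRoot.root (realPolyQ R)) ⊆ Set.range Sum.inl ↔ ∀ φ : realField R →+* ℝ, 0 < φ t := by
  rw [← forall_hilbertSymbol_completion_root_eq_one_iff_totallyPositive hR]
  constructor
  · intro h w
    by_contra hw
    have hw' := (hilbertSymbol_ne_one_iff _ _).1 hw
    obtain ⟨v, hv⟩ := h (show Sum.inr w ∈ badPlaces t (AdjoinRoot.root (realPolyQ R)) by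
      rw [mem_badPlaces_iff, placeSymbol_inr]; exact hw')
    exact Sum.inl_ne_inr hv
  · rintro h (v | w) hp
    · exact ⟨v, rfl⟩
    · rw [mem_badPlaces_iff, placeSymbol_inr, h w] at hp
      norm_num at hp

/-- **Total positivity on `F` vs. on `E`**: `t ∈ F` is positive at every real embedding of `F` iff
`Re τ(ι t) > 0` at every complex embedding `τ` of `E` (the phrasing of `Ring2WeilCoverageCMFieldCellsSign` /
`…KaehlerIffAnyCM`: a row `W_{2k}.E.[q]`, `k` even, carries a polarized member iff this holds) — every `τ|_F` is
real (`F` totally real) and every real embedding of `F` extends to `E`. [cite: Deligne1982HodgeCycles, §4 (1)] -/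
theorem forall_re_embedding_pos_iff_totallyPositive
    (hR : ∀ s : ℂ, Polynomial.eval₂ (Int.castRingHom ℂ) s R = 0 → s.im = 0 ∧ s.re < 0) (t : realField R) :
    (∀ τ : cmField R →+* ℂ, 0 < (τ (realToCM R t)).re) ↔ ∀ φ : realField R →+* ℝ, 0 < φ t := by
  haveI := isTotallyReal_realField (R := R) hR
  constructor
  · intro h φ
    let ψ : realField R →+* ℂ := (algebraMap ℝ ℂ).comp φ
    letI : Algebra (realField R) ℂ := ψ.toAlgebra
    let τ : cmField R →ₐ[realField R] ℂ := IsAlgClosed.lift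
    have h1 := h τ.toRingHom
    have h2 : τ.toRingHom (realToCM R t) = ψ t := by
      rw [← algebraMap_realField_eq]
      exact τ.commutes t
    rw [h2] at h1
    simpa [ψ] using h1
  · intro h τ
    let ψ : realField R →+* ℂ := τ.comp (realToCM R)
    have hψ : ComplexEmbedding.IsReal ψ := IsTotallyReal.complexEmbedding_isReal ψ
    have h1 : τ (realToCM R t) = ((hψ.embedding t : ℝ) : ℂ) := by
      rw [ComplexEmbedding.IsReal.coe_embedding_apply]; rfl
    rw [h1, Complex.ofReal_re]
    exact h _

/-- **For totally positive `q, q'`: `[q] = [q']` iff the FINITE bad places agree** — `T(q) = T(q')` as sets of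
finite places of `F`, exactly the labels of §b03.5. [cite: Deligne1982HodgeCycles, §4 (1) and Prop. 4.1]
[cite: Omeara1963, §65D Thm. 65:23] -/
theorem mk_eq_mk_iff_finite_badPlaces_eq
    (hR : ∀ s : ℂ, Polynomial.eval₂ (Int.castRingHom ℂ) s R = 0 → s.im = 0 ∧ s.re < 0)
    {q q' : (realField R)ˣ} (hq : ∀ φ : realField R →+* ℝ, 0 < φ q) (hq' : ∀ φ : realField R →+* ℝ, 0 < φ q') :
    (QuotientGroup.mk q : cmNormResidueGroup R) = QuotientGroup.mk q' ↔
      {v : HeightOneSpectrum (𝓞 (realField R)) |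
          hilbertSymbol (v.adicCompletion (realField R)) (algebraMap (realField R) _ (q : realField R))
            (algebraMap (realField R) _ (AdjoinRoot.root (realPolyQ R))) = -1} =
        {v : HeightOneSpectrum (𝓞 (realField R)) |
          hilbertSymbol (v.adicCompletion (realField R)) (algebraMap (realField R) _ (q' : realField R))
            (algebraMap (realField R) _ (AdjoinRoot.root (realPolyQ R))) = -1} := by
  rw [mk_eq_mk_iff_badPlaces_eq, ← preimage_inl_badPlaces, ← preimage_inl_badPlaces]
  have h1 := (badPlaces_subset_range_inl_iff_totallyPositive hR (q : realField R)).2 hq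
  have h2 := (badPlaces_subset_range_inl_iff_totallyPositive hR (q' : realField R)).2 hq'
  constructor
  · intro h; rw [h]
  · intro h
    rw [← Set.image_preimage_eq_of_subset h1, ← Set.image_preimage_eq_of_subset h2, h]

/-! ### §5 Parity, support and realisation of the `T`-sets (Hilbert reciprocity 71:18; O'Meara 71:19) -/

/-- **`|T(q)|` is EVEN** for every `q ∈ F^×` (Hilbert's reciprocity law `∏_𝔭 (q, θ)_𝔭 = 1`, O'Meara 71:18, a
theorem of the tree): the census's «finite EVEN sets `T`». [cite: Omeara1963, §71D Thm. 71:18] -/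
theorem even_ncard_badPlaces (q : (realField R)ˣ) :
    (badPlaces (q : realField R) (AdjoinRoot.root (realPolyQ R))).Finite ∧
      Even (badPlaces (q : realField R) (AdjoinRoot.root (realPolyQ R))).ncard := by
  refine ⟨badPlaces_finite (Units.ne_zero _) root_realPolyQ_ne_zero, ?_⟩
  rw [ncard_badPlaces (Units.ne_zero _) root_realPolyQ_ne_zero]
  exact (hilbertReciprocity_holds (realField R) (q : realField R) (AdjoinRoot.root (realPolyQ R))
    (Units.ne_zero _) root_realPolyQ_ne_zero).2

/-- For TOTALLY POSITIVE `q` the finite bad places alone are even in number. [cite: Omeara1963, §71D Thm. 71:18] -/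
theorem even_ncard_finite_badPlaces
    (hR : ∀ s : ℂ, Polynomial.eval₂ (Int.castRingHom ℂ) s R = 0 → s.im = 0 ∧ s.re < 0)
    {q : (realField R)ˣ} (hq : ∀ φ : realField R →+* ℝ, 0 < φ q) :
    Even {v : HeightOneSpectrum (𝓞 (realField R)) |
        hilbertSymbol (v.adicCompletion (realField R)) (algebraMap (realField R) _ (q : realField R))
          (algebraMap (realField R) _ (AdjoinRoot.root (realPolyQ R))) = -1}.ncard := by
  have h := (hilbertReciprocity_holds (realField R) (q : realField R) (AdjoinRoot.root (realPolyQ R))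
    (Units.ne_zero _) root_realPolyQ_ne_zero).2
  have hinf : {w : InfinitePlace (realField R) |
      hilbertSymbol w.Completion (algebraMap (realField R) _ (q : realField R))
        (algebraMap (realField R) _ (AdjoinRoot.root (realPolyQ R))) = -1} = ∅ := by
    ext w
    simp only [Set.mem_setOf_eq, Set.mem_empty_iff_false, iff_false]
    rw [(forall_hilbertSymbol_completion_root_eq_one_iff_totallyPositive hR (q : realField R)).2 hq w]
    norm_num
  rwa [hinf, Set.ncard_empty, add_zero] at h

/-- **`T(q)` consists of NON-SPLIT places**: at a finite place where `θ` is a square in `F_v` (a place of `F`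
split in `E`) the symbol `(q, θ)_v` is `1`. [cite: Omeara1963, §63B] -/
theorem not_isSquare_of_hilbertSymbol_eq_neg_one {v : HeightOneSpectrum (𝓞 (realField R))} {t : realField R}
    (h : hilbertSymbol (v.adicCompletion (realField R)) (algebraMap (realField R) _ t)
      (algebraMap (realField R) _ (AdjoinRoot.root (realPolyQ R))) = -1) :
    ¬ IsSquare (algebraMap (realField R) (v.adicCompletion (realField R)) (AdjoinRoot.root (realPolyQ R))) := by
  intro hsq
  rw [hilbertSymbol_comm, hilbertSymbol_eq_one_of_isSquare hsq
    ((_root_.map_ne_zero _).2 root_realPolyQ_ne_zero)] at h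
  norm_num at h

omit [Fact (Irreducible (cmPolyQ R))] in
/-- **REALISATION (O'Meara 71:19 on the carriers): every finite EVEN set `S` of finite places of `F` at which
`θ` is a local non-square is `T(q)` for some TOTALLY POSITIVE `q ∈ F^×`** — together with
`mk_eq_mk_iff_finite_badPlaces_eq` and `even_ncard_finite_badPlaces`: the totally positive classes of
`F^×/Nm_{E/F}(E^×)` (the polarized rows `W_{2k}.E.δ`, `k` even) are in canonical bijection with the finite even
subsets of the non-split finite places of `F`. [cite: Omeara1963, §71 Thm. 71:19 and Cor. 71:19a]
[cite: Deligne1982HodgeCycles, §4 (1) and Prop. 4.1] [cite: Landherr1936HermitianForms] -/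
theorem exists_totallyPositive_badPlaces_eq
    (hR : ∀ s : ℂ, Polynomial.eval₂ (Int.castRingHom ℂ) s R = 0 → s.im = 0 ∧ s.re < 0)
    (S : Finset (HeightOneSpectrum (𝓞 (realField R)))) (hS : Even S.card)
    (hns : ∀ v ∈ S, ¬ IsSquare (algebraMap (realField R) (v.adicCompletion (realField R))
      (AdjoinRoot.root (realPolyQ R)))) :
    ∃ q : (realField R)ˣ, (∀ φ : realField R →+* ℝ, 0 < φ q) ∧
      {v : HeightOneSpectrum (𝓞 (realField R)) |
          hilbertSymbol (v.adicCompletion (realField R)) (algebraMap (realField R) _ (q : realField R))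
            (algebraMap (realField R) _ (AdjoinRoot.root (realPolyQ R))) = -1} = ↑S := by
  classical
  obtain ⟨t, ht0, hfin, hinf⟩ := exists_hilbertSymbol_eq_neg_one_iff_of_hilbertReciprocity (realField R)
    (hilbertReciprocity_holds (realField R)) (AdjoinRoot.root (realPolyQ R)) S ∅ (by simp)
    (by simpa using hS) hns (by simp)
  refine ⟨Units.mk0 t ht0, ?_, ?_⟩
  · rw [Units.val_mk0, ← forall_hilbertSymbol_completion_root_eq_one_iff_totallyPositive hR]
    intro w
    rw [← hilbertSymbol_ne_neg_one_iff, Ne, hinf w]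
    simp
  · ext v
    rw [Set.mem_setOf_eq, Units.val_mk0, hfin v, Finset.mem_coe]

end Summit.HodgeConjecture.HodgeConjecture.Ring2.WeilCoverageCM

end
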